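import Summits.HodgeConjecture.HodgeCM.PerL34.S1StrengthCR_1

/-! PORT of `HodgeCM/PerL34/S1StrengthCR.lean` (HodgeCMPerL run 82) — part 2: continuation of `Summits.HodgeConjecture.HodgeCM.PerL34.S1StrengthCR_1` (split at a top-level declaration boundary by port_pkg.py; scope re-opened below; declarations unchanged). -/

-- port_pkg: scope re-opened for this part (file-level context, then the namespace/section stack open at the cut)
noncomputable section
open Complex
namespace HodgeCM
namespace PerL34
namespace S1StrengthCR
open HodgeCM.PerL34.BallModel HodgeCM.PerL34.BallSpans HodgeCM.PerL34.BallFrame HodgeCM.PerL34.CharSpans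
  HodgeCM.PerL34.CharSpansWeil HodgeCM.PerL34.CharSpansCR HodgeCM.PerL34.WedgeNonvanishing
  HodgeCM.PerL34.WedgeToClasses HodgeCM.PerL34.P43WeilModel HodgeCM.PerL34.P43Isotypic HodgeCM.PerL34.StepsVacuity
variable {U : Universe} (T : U.ThetaModel)
namespace Junk
variable {T}
variable {L : CMField} {ι₁ : L →+* ℂ} {V : HermSpace3 L ι₁} {c : SeesawCtx L}
variable (C : SplitHolConfig) {Γ₀ : Level V} (hC : HeredAt T V c Γ₀)
include hC
/-- (Ported verbatim from the HodgeCMPerL package; no docstring in the source.) -/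
theorem cls_of_mem_zero {Γ' : Level V} (h : Γ'.Γ ≤ Γ₀.Γ) {u : Ball → (Fin 2 → ℂ)} (hu : u ∈ C.𝒱 0)
    (hu0 : u ≠ 0) : cls C hC Γ' u = (hC Γ' h).1.choose := by
  have h1 : u ∉ C.𝒱 1 := by
    intro h1
    have : u ∈ C.𝒱 0 ⊓ C.𝒱 1 := Submodule.mem_inf.mpr ⟨hu, h1⟩
    rw [C.inf_eq_bot, Submodule.mem_bot] at this
    exact hu0 this
  simp only [cls, dif_pos h, if_neg hu0, if_neg h1]

/-- **The junk data** (`G_c := Unit`, `G_f := U(2,1)`, `Γ := Γg` any subgroup (the diagonal `Γd`, or a subgroup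
of it), slices from the junk theta-kernel models, `lvl := Γ₀`, the junk class map). -/
def M (Γg : Subgroup (U21 × Unit × U21)) : CharLineSpansCR T V c where
  Gc := Unit
  Gf := U21
  Γ := Γg
  ThetaP := fun i _ => (Mk C i).ThetaP
  lvl := fun _ => Γ₀
  cls := cls C hC

/-- **The junk package** (for any `Γg` inside the diagonal, where N10 holds). -/
def pkg (Γg : Subgroup (U21 × Unit × U21)) (hΓg : Γg ≤ Γd) [hX : Nonempty (T.t12 V c).X] :
    WeilPackageCR T (M C hC Γg) where
  S := fun i _ => Sp C i
  Mk := fun i _ => Mk C i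
  hM := fun _ _ => rfl
  Kc := Unit
  P := U21 → (Fin 2 → ℂ)
  ρP := ρP
  ωinf := fun i _ => ωinf C i
  ρ := fun i _ => ρK C i
  W := fun i _ => typing C i
  hΘ := fun i _ γ hγ => hΘ C i γ (hΓg hγ)
  hX1 := fun i _ => hX1 C i
  hne := fun i => ⟨Classical.choice hX, thetaP_ne_bot C i⟩

/-- For `Γg := Γd`, `Δ = ⊤`, in particular dense. -/
theorem dense : Dense ((M C hC Γd).toCharLineSpans.toBallSpanModel.toBallFormsModel.Δ : Set U21) := by
  have h : ((M C hC Γd).toCharLineSpans.toBallSpanModel.toBallFormsModel.Δ : Set U21) = Set.univ := by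
    refine Set.eq_univ_of_forall fun g => ?_
    change g ∈ (Γd.map (MonoidHom.fst U21 (Unit × U21)) : Subgroup U21)
    exact Subgroup.mem_map.mpr ⟨(g, (), g), ⟨g, rfl⟩, rfl⟩
  rw [h]
  exact dense_univ

/-- The generators of the induced forms model ARE the two families: `gen i χ = 𝒱ᵢ`. -/
theorem mem_gen_iff (Γg : Subgroup (U21 × Unit × U21)) (i : Fin 2) (χ : (T.t12 V c).X) (u : Ball → (Fin 2 → ℂ)) :
    u ∈ (M C hC Γg).toCharLineSpans.toBallSpanModel.toLineSpans.gen i χ ↔ u ∈ C.𝒱 i := by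
  change R u ∈ ((Mk C i).ThetaP).map _ ↔ _
  rw [Submodule.mem_map]
  constructor
  · rintro ⟨F, hF, hFu⟩
    obtain ⟨s, rfl⟩ := (mem_thetaP_iff C i F).mp hF
    have hs : (s : U21 → (Fin 2 → ℂ)) = R u := by
      rw [← hFu]
      exact (uEval_theta_single_one C i s).symm
    obtain ⟨v, hv, hvs⟩ := Submodule.mem_map.mp s.2
    rwa [← R_injective (hvs.trans hs)]
  · intro hu
    refine ⟨theta C i (Finsupp.single 1 ⟨R u, Submodule.mem_map_of_mem hu⟩),
      (mem_thetaP_iff C i _).mpr ⟨_, rfl⟩, ?_⟩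
    exact uEval_theta_single_one C i _

/-- (Ported verbatim from the HodgeCMPerL package; no docstring in the source.) -/
theorem dict₀ (Γg : Subgroup (U21 × Unit × U21)) :
    (M C hC Γg).toCharLineSpans.toBallSpanModel.toBallFormsModel.toFormsModelT.Dict_thetaClass₀ T c := by
  intro d _ u hu Γ' hΓ'
  have hu' : u ∈ C.𝒱 0 := (mem_gen_iff C hC Γg 0 d u).mp hu
  change Γ'.Γ ≤ Γ₀.Γ at hΓ'
  change cls C hC Γ' u ∈ _
  by_cases hu0 : u = 0
  · subst hu0
    exact (cls_zero C hC hΓ').1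
  · rw [cls_of_mem_zero C hC hΓ' hu' hu0]
    exact (hC Γ' hΓ').1.choose_spec.1

/-- (Ported verbatim from the HodgeCMPerL package; no docstring in the source.) -/
theorem dict₁ (Γg : Subgroup (U21 × Unit × U21)) :
    (M C hC Γg).toCharLineSpans.toBallSpanModel.toBallFormsModel.toFormsModelT.Dict_thetaClass₁ T c := by
  intro d _ u hu Γ' hΓ'
  have hu' : u ∈ C.𝒱 1 := (mem_gen_iff C hC Γg 1 d u).mp hu
  change Γ'.Γ ≤ Γ₀.Γ at hΓ'
  change cls C hC Γ' u ∈ _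
  by_cases hu0 : u = 0
  · subst hu0
    exact (cls_zero C hC hΓ').2
  · rw [cls_of_mem_one C hC hΓ' hu' hu0]
    exact (hC Γ' hΓ').1.choose_spec.2.choose_spec.1

/-- (Ported verbatim from the HodgeCMPerL package; no docstring in the source.) -/
theorem dict_cup (Γg : Subgroup (U21 × Unit × U21)) :
    (M C hC Γg).toCharLineSpans.toBallSpanModel.toBallFormsModel.toFormsModelT.toFormsModel.Dict_cupWedge := by
  intro d₁ d₂ u₁ hu₁ u₂ hu₂ Γ' hΓ₁ _ hx
  have hu₁' : u₁ ∈ C.𝒱 0 := (mem_gen_iff C hC Γg 0 d₁ u₁).mp hu₁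
  have hu₂' : u₂ ∈ C.𝒱 1 := (mem_gen_iff C hC Γg 1 d₂ u₂).mp hu₂
  change Γ'.Γ ≤ Γ₀.Γ at hΓ₁
  change U.cup2C (U.pms L ι₁ V Γ') 1 (cls C hC Γ' u₁) (cls C hC Γ' u₂) ≠ 0
  obtain ⟨x, hli⟩ := hx
  have h10 : u₁ ≠ 0 := by
    rintro rfl
    exact LinearIndependent.ne_zero 0 hli rfl
  have h20 : u₂ ≠ 0 := by
    rintro rfl
    exact LinearIndependent.ne_zero 1 hli rfl
  rw [cls_of_mem_zero C hC hΓ₁ hu₁' h10, cls_of_mem_one C hC hΓ₁ hu₂' h20]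
  exact (hC Γ' hΓ₁).1.choose_spec.2.choose_spec.2

end Junk

/-! ## 4. The verdict -/

/-- **Upper bound (kernel reduction)**: over any `SplitHolConfig`, hereditary A6 and non-empty character sets give
the CR binder, by the junk package. -/
theorem weilStepsInputCR_of_hereditary (C : SplitHolConfig) (hX : CharsNonempty T)
    (h : Open_thetaWedgeHereditary T) : WeilStepsInputCR T := by
  intro L ι₁ V c hc
  obtain ⟨Γ₀, hC⟩ := h V c hc
  haveI : Nonempty (T.t12 V c).X := hX V c hc
  exact ⟨Junk.M C hC Junk.Γd, ⟨Junk.pkg C hC Junk.Γd le_rfl⟩, Junk.dense C hC, Junk.dict₀ C hC Junk.Γd,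
    Junk.dict₁ C hC Junk.Γd, Junk.dict_cup C hC Junk.Γd⟩

/-- **P1, S1 half, the CR binder (referee A round 15)**: over any `SplitHolConfig` and given node N31
(`T.Open_chars`), `WeilStepsInputCR T` is EQUIVALENT to hereditary A6 together with the non-emptiness of the
character sets. -/
theorem weilStepsInputCR_iff (C : SplitHolConfig) (hch : T.Open_chars) :
    WeilStepsInputCR T ↔ Open_thetaWedgeHereditary T ∧ CharsNonempty T :=
  ⟨fun h => ⟨hereditary_of_CR T hch h, charsNonempty_of_CR T h⟩,
    fun h => weilStepsInputCR_of_hereditary T C h.2 h.1⟩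

/-- The same for pv03's `WeilStepsInput T`. -/
theorem weilStepsInput_iff (C : SplitHolConfig) (hch : T.Open_chars) :
    WeilStepsInput T ↔ Open_thetaWedgeHereditary T ∧ CharsNonempty T :=
  ⟨fun h => ⟨hereditary_of_charSpans T hch (charSpanStepsInput_of_weil T h),
      charsNonempty_of_charSpans T (charSpanStepsInput_of_weil T h)⟩,
    fun h => weilStepsInput_of_CR T (weilStepsInputCR_of_hereditary T C h.2 h.1)⟩

/-- The same for pv02-g2's `CharSpanStepsInput T`. -/
theorem charSpanStepsInput_iff (C : SplitHolConfig) (hch : T.Open_chars) :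
    CharSpanStepsInput T ↔ Open_thetaWedgeHereditary T ∧ CharsNonempty T :=
  ⟨fun h => ⟨hereditary_of_charSpans T hch h, charsNonempty_of_charSpans T h⟩,
    fun h => charSpanStepsInput_of_CR T (weilStepsInputCR_of_hereditary T C h.2 h.1)⟩

/-- In particular the three binders of the S1 chain are equivalent to EACH OTHER over any `SplitHolConfig`: the
Weil typing, (X1)/(X2) and N10 add no strength at the level of `T`. -/
theorem weilStepsInputCR_iff_charSpanStepsInput (C : SplitHolConfig) (hch : T.Open_chars) :
    WeilStepsInputCR T ↔ CharSpanStepsInput T :=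
  (weilStepsInputCR_iff T C hch).trans (charSpanStepsInput_iff T C hch).symm

end S1StrengthCR
end PerL34
end HodgeCM

end

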